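/-
Copyright (c) 2026 the pub-hodgecm-mathlib formalisation cell (harness21).  Prover seat hodgecm-mathlib-K2E3-p17 (g2),
Track B «K2-LIT» ∕ h413, line `K2_E3_EllipticInputs`, unit U5Kazhdan ∕ annex U5bWildPlancherel — ROAD K-EP toward #20′ `sig_K2E3PseudoCoeffPosOnePi2`
(dealer K2E3-plan (g1) 23:40:43Z (e) «#20′ ↦ K2E3-p17 (g2)», FIRST BRICK): THE VALUE AT `1` OF THE K-TYPE EULER–POINCARÉ FUNCTION.  2026-09-03.
-/
import Literature.NumberTheory.Rogawski1990.Ch12Sec5Defs      -- ★ `Ch12Sec5.EllipticData`, `IsPseudoCoeff` (the POS-ONE glue of §3)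
import Mathlib.RepresentationTheory.Character                 -- `Representation.character`, `char_one`
import HarnessLib

/-!
# K2_E3 road (h413 = stmt-HodgeConjecture-24833), ROAD K-EP — first brick: `f_EP(1) = ν(P₀)⁻¹·dim V^{U₀} + ν(P₂)⁻¹·dim V^{U₂} − ν(P₁)⁻¹·dim V^{U₁}`

Cell `pub/hodgecm-mathlib` (D-0151), Track B; dealer K2E3-plan (g1) DEAL 23:40:43Z (e) (K2E3-p20 (g2) PLANNING REMARK 23:36:34Z «ROAD K-EP for POS-ONE at
`π²(ξ)`»).  THEOREMS ONLY (no definition ∕ instance ∕ notation ∕ named fact ∕ `sorry`); imports ★ Literature + Mathlib only; GENERIC (any group `G`).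

WHAT.  The K-type Euler–Poincaré function of the `U(3)` tree that ★ K1 (`F0P3cStCharTSK1UnrPseudoCoeffWitness.isPseudoCoeff_epFunction_of_unramified_explicit`,
its ramified ∕ wild twins ★ `…K1PseudoCoeffWitnessRamified.isPseudoCoeff_epFunction_of_neg_explicit`, ★ `K2E3K1PseudoCoeffWitnessWild.isPseudoCoeff_epFunction_of_
ramificationIdx_ne_one_explicit`) proves to be a pseudo-coefficient of EVERY irreducible class `σ = ⟦r⟧` with a level-`e` fixed vector is, in those files' letters,
`f = ν(P₀)⁻¹ • f₀ + ν(P₂)⁻¹ • f₂ − ν(P₁)⁻¹ • f₁`, where `P₀ ∕ P₂ ∕ P₁` are the stabilisers of the head ∕ tail ∕ of the base edge `d₁`, `τᵢ = r|_{Pᵢ}` on the fixed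
vectors `V^{Uᵢ}` of the level groups, and `fᵢ = 𝟙_{Pᵢ} · χ_{τᵢ}(·⁻¹)` (`hfPᵢ : fᵢ g = χ_{τᵢ}(g⁻¹)` on `Pᵢ`) [SchneiderStuhler1997 §III.4, Thm. III.4.16; Kottwitz1988 §2].
This file computes its VALUE AT THE IDENTITY — `χ_τ(1) = dim` (Mathlib `Representation.char_one`):
* §1 `piece_apply_one` — `fᵢ 1 = finrank ℂ V^{Uᵢ}`; `epFunction_apply_one` — for any complex coefficients `c₀ c₂ c₁`,
  `(c₀ • f₀ + c₂ • f₂ − c₁ • f₁) 1 = c₀·dim₀ + c₂·dim₂ − c₁·dim₁`.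
* §2 with the K1 coefficients `cᵢ = ν(Pᵢ)⁻¹` (a measure `ν` on `G`, letters VERBATIM `(((ν.real (Pᵢ : Set G))⁻¹ : ℂ))`): `epFunction_apply_one_eq_ofReal` (the value is the
  real number `ν(P₀)⁻¹·dim₀ + ν(P₂)⁻¹·dim₂ − ν(P₁)⁻¹·dim₁`), `epFunction_apply_one_im` (`(f 1).im = 0`), `epFunction_apply_one_re`, and
  `epFunction_apply_one_re_pos_iff` : `0 < (f 1).re ↔ ν(P₁)⁻¹·dim₁ < ν(P₀)⁻¹·dim₀ + ν(P₂)⁻¹·dim₂` — POS-ONE for `σ` IS A K-TYPE DIMENSION INEQUALITY.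
* §3 `posOne_of_isPseudoCoeff_epFunction` — the glue to the organ's POS-ONE ∃-form (`Rung0TwentyTwo` :377 ∕ tier-0 `stub_pseudoCoeffPosOne`): at any §12.5 datum `𝔇`
  (★ `Ch12Sec5.EllipticData`), if the EP function is a pseudo-coefficient of `σ` (★ K1's conclusion, BY SHAPE) and the dimension inequality holds, then
  `∃ f, 𝔇.IsPseudoCoeff σ f ∧ 0 < (f 1).re ∧ (f 1).im = 0`.
No harmonic analysis: the Plancherel-free road to the formal-degree positivity «`f_π(1) = d(π) > 0`» [Rogawski1990 §12.7 p. 194] for the classes the EP function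
serves (K2E3-p20's worked depth-zero case: `f(1)·ν(I) = q³∕(q³+1) + 1∕(q+1) − 1 > 0` for the Iwahori-spherical `π²(ξ₀)` — second brick).

HONEST LABEL: HC_CM is proved only modulo the 7 printed citations (2 remaining named inputs: hLiu418 = stmt-HodgeConjecture-24832, h413 =
stmt-HodgeConjecture-24833) until rung 0 closes; `--supports stmt-HodgeConjecture-24833` helper, COUNT-NEUTRAL (the socket #20′ it serves is not yet minted);
it pays no socket and retires no organ letter by itself.

## References
* [SchneiderStuhler1997] P. Schneider, U. Stuhler, *Representation theory and sheaves on the Bruhat–Tits building*, Publ. Math. IHÉS 85 (1997), §III.4, Thm. III.4.16.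
* [Kottwitz1988] R. E. Kottwitz, *Tamagawa numbers*, Ann. of Math. 127 (1988), §2 Theorem 2 (the Euler–Poincaré function).
* [Rogawski1990] J. D. Rogawski, *Automorphic Representations of Unitary Groups in Three Variables*, Ann. of Math. Stud. 123 (1990), §12.6 p. 187, §12.7 p. 194.
-/

set_option autoImplicit false
-- the mandated namespace has the single-problem summit's repeated segment (`HodgeConjecture.HodgeConjecture`)
set_option linter.dupNamespace false

noncomputable section

open MeasureTheory
open Literature.NumberTheory.Rogawski1990 Literature.NumberTheory.Rogawski1990.Ch12Sec5
open Literature.NumberTheory.Automorphic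

namespace Summit.HodgeConjecture.HodgeConjecture.Cruxes.H413.K2E3EPFunctionValueAtOne

/-! ## §1  The pieces and the Euler–Poincaré combination at `1` (pure algebra, any group) -/

/-- **A K-type piece at the identity: `fᵢ(1) = dim V^{Uᵢ}`.**  If `f g = χ_τ(g⁻¹)` on the subgroup `P` (`τ` a finite-dimensional representation of `P`), then
`f 1 = χ_τ(1) = finrank`. [cite: SchneiderStuhler1997, §III.4] -/
theorem piece_apply_one {G : Type*} [Group G] {P : Subgroup G} {W : Type*} [AddCommGroup W] [Module ℂ W] [FiniteDimensional ℂ W]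
    (τ : Representation ℂ ↥P W) {f : G → ℂ} (hfP : ∀ (g : G) (hg : g ∈ P), f g = τ.character ⟨g, hg⟩⁻¹) :
    f 1 = (Module.finrank ℂ W : ℂ) := by
  have h1 : (⟨(1 : G), P.one_mem⟩ : ↥P)⁻¹ = 1 := by
    rw [inv_eq_one]; rfl
  rw [hfP 1 P.one_mem, h1, Representation.char_one]

/-- **The Euler–Poincaré combination at the identity**, for arbitrary complex coefficients: with `fᵢ g = χ_{τᵢ}(g⁻¹)` on `Pᵢ` (`i = 0, 2, 1`: head ∕ tail ∕ edge
stabilisers), `(c₀ • f₀ + c₂ • f₂ − c₁ • f₁) 1 = c₀·dim V^{U₀} + c₂·dim V^{U₂} − c₁·dim V^{U₁}`. [cite: SchneiderStuhler1997, Thm. III.4.16] [cite: Kottwitz1988, §2 Theorem 2] -/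
theorem epFunction_apply_one {G : Type*} [Group G] {P₀ P₂ P₁ : Subgroup G}
    {W₀ W₂ W₁ : Type*} [AddCommGroup W₀] [Module ℂ W₀] [FiniteDimensional ℂ W₀] [AddCommGroup W₂] [Module ℂ W₂] [FiniteDimensional ℂ W₂]
    [AddCommGroup W₁] [Module ℂ W₁] [FiniteDimensional ℂ W₁]
    (τ₀ : Representation ℂ ↥P₀ W₀) (τ₂ : Representation ℂ ↥P₂ W₂) (τ₁ : Representation ℂ ↥P₁ W₁)
    {f₀ f₂ f₁ : G → ℂ}
    (hfP₀ : ∀ (g : G) (hg : g ∈ P₀), f₀ g = τ₀.character ⟨g, hg⟩⁻¹)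
    (hfP₂ : ∀ (g : G) (hg : g ∈ P₂), f₂ g = τ₂.character ⟨g, hg⟩⁻¹)
    (hfP₁ : ∀ (g : G) (hg : g ∈ P₁), f₁ g = τ₁.character ⟨g, hg⟩⁻¹)
    (c₀ c₂ c₁ : ℂ) :
    (c₀ • f₀ + c₂ • f₂ - c₁ • f₁) 1 =
      c₀ * (Module.finrank ℂ W₀ : ℂ) + c₂ * (Module.finrank ℂ W₂ : ℂ) - c₁ * (Module.finrank ℂ W₁ : ℂ) := by
  simp only [Pi.add_apply, Pi.sub_apply, Pi.smul_apply, smul_eq_mul]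
  rw [piece_apply_one τ₀ hfP₀, piece_apply_one τ₂ hfP₂, piece_apply_one τ₁ hfP₁]

/-! ## §2  With the K1 coefficients `ν(Pᵢ)⁻¹`: the value is real; POS-ONE is a dimension inequality -/

section Measure

variable {G : Type*} [Group G] [MeasurableSpace G] (ν : Measure G) {P₀ P₂ P₁ : Subgroup G}
  {W₀ W₂ W₁ : Type*} [AddCommGroup W₀] [Module ℂ W₀] [FiniteDimensional ℂ W₀] [AddCommGroup W₂] [Module ℂ W₂] [FiniteDimensional ℂ W₂]
  [AddCommGroup W₁] [Module ℂ W₁] [FiniteDimensional ℂ W₁]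
  (τ₀ : Representation ℂ ↥P₀ W₀) (τ₂ : Representation ℂ ↥P₂ W₂) (τ₁ : Representation ℂ ↥P₁ W₁)
  {f₀ f₂ f₁ : G → ℂ}

/-- **`f_EP(1)` with the K1 coefficients is the real number `ν(P₀)⁻¹·dim₀ + ν(P₂)⁻¹·dim₂ − ν(P₁)⁻¹·dim₁`** (coefficient letters VERBATIM as in ★ K1's conclusion:
`(((ν.real (Pᵢ : Set G))⁻¹ : ℂ))`). [cite: SchneiderStuhler1997, Thm. III.4.16] [cite: Kottwitz1988, §2 Theorem 2] -/
theorem epFunction_apply_one_eq_ofReal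
    (hfP₀ : ∀ (g : G) (hg : g ∈ P₀), f₀ g = τ₀.character ⟨g, hg⟩⁻¹)
    (hfP₂ : ∀ (g : G) (hg : g ∈ P₂), f₂ g = τ₂.character ⟨g, hg⟩⁻¹)
    (hfP₁ : ∀ (g : G) (hg : g ∈ P₁), f₁ g = τ₁.character ⟨g, hg⟩⁻¹) :
    ((((ν.real (P₀ : Set G))⁻¹ : ℂ)) • f₀ + (((ν.real (P₂ : Set G))⁻¹ : ℂ)) • f₂ - (((ν.real (P₁ : Set G))⁻¹ : ℂ)) • f₁) 1 =
      (((ν.real (P₀ : Set G))⁻¹ * (Module.finrank ℂ W₀ : ℝ) + (ν.real (P₂ : Set G))⁻¹ * (Module.finrank ℂ W₂ : ℝ)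
          - (ν.real (P₁ : Set G))⁻¹ * (Module.finrank ℂ W₁ : ℝ) : ℝ) : ℂ) := by
  rw [epFunction_apply_one τ₀ τ₂ τ₁ hfP₀ hfP₂ hfP₁]
  push_cast
  ring

/-- **`f_EP(1)` is real**: `(f 1).im = 0` (the third conjunct of the organ's POS-ONE form). [cite: Kottwitz1988, §2 Theorem 2] -/
theorem epFunction_apply_one_im
    (hfP₀ : ∀ (g : G) (hg : g ∈ P₀), f₀ g = τ₀.character ⟨g, hg⟩⁻¹)
    (hfP₂ : ∀ (g : G) (hg : g ∈ P₂), f₂ g = τ₂.character ⟨g, hg⟩⁻¹)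
    (hfP₁ : ∀ (g : G) (hg : g ∈ P₁), f₁ g = τ₁.character ⟨g, hg⟩⁻¹) :
    (((((ν.real (P₀ : Set G))⁻¹ : ℂ)) • f₀ + (((ν.real (P₂ : Set G))⁻¹ : ℂ)) • f₂ - (((ν.real (P₁ : Set G))⁻¹ : ℂ)) • f₁) 1).im = 0 := by
  rw [epFunction_apply_one_eq_ofReal ν τ₀ τ₂ τ₁ hfP₀ hfP₂ hfP₁, Complex.ofReal_im]

/-- **The real part of `f_EP(1)`**: `(f 1).re = ν(P₀)⁻¹·dim₀ + ν(P₂)⁻¹·dim₂ − ν(P₁)⁻¹·dim₁`. [cite: Kottwitz1988, §2 Theorem 2] -/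
theorem epFunction_apply_one_re
    (hfP₀ : ∀ (g : G) (hg : g ∈ P₀), f₀ g = τ₀.character ⟨g, hg⟩⁻¹)
    (hfP₂ : ∀ (g : G) (hg : g ∈ P₂), f₂ g = τ₂.character ⟨g, hg⟩⁻¹)
    (hfP₁ : ∀ (g : G) (hg : g ∈ P₁), f₁ g = τ₁.character ⟨g, hg⟩⁻¹) :
    (((((ν.real (P₀ : Set G))⁻¹ : ℂ)) • f₀ + (((ν.real (P₂ : Set G))⁻¹ : ℂ)) • f₂ - (((ν.real (P₁ : Set G))⁻¹ : ℂ)) • f₁) 1).re =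
      (ν.real (P₀ : Set G))⁻¹ * (Module.finrank ℂ W₀ : ℝ) + (ν.real (P₂ : Set G))⁻¹ * (Module.finrank ℂ W₂ : ℝ)
        - (ν.real (P₁ : Set G))⁻¹ * (Module.finrank ℂ W₁ : ℝ) := by
  rw [epFunction_apply_one_eq_ofReal ν τ₀ τ₂ τ₁ hfP₀ hfP₂ hfP₁, Complex.ofReal_re]

/-- **POS-ONE IS A K-TYPE DIMENSION INEQUALITY**: `0 < (f_EP 1).re ↔ ν(P₁)⁻¹·dim V^{U₁} < ν(P₀)⁻¹·dim V^{U₀} + ν(P₂)⁻¹·dim V^{U₂}`.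
[cite: Kottwitz1988, §2 Theorem 2] [cite: Rogawski1990, §12.7 p. 194] -/
theorem epFunction_apply_one_re_pos_iff
    (hfP₀ : ∀ (g : G) (hg : g ∈ P₀), f₀ g = τ₀.character ⟨g, hg⟩⁻¹)
    (hfP₂ : ∀ (g : G) (hg : g ∈ P₂), f₂ g = τ₂.character ⟨g, hg⟩⁻¹)
    (hfP₁ : ∀ (g : G) (hg : g ∈ P₁), f₁ g = τ₁.character ⟨g, hg⟩⁻¹) :
    0 < (((((ν.real (P₀ : Set G))⁻¹ : ℂ)) • f₀ + (((ν.real (P₂ : Set G))⁻¹ : ℂ)) • f₂ - (((ν.real (P₁ : Set G))⁻¹ : ℂ)) • f₁) 1).re ↔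
      (ν.real (P₁ : Set G))⁻¹ * (Module.finrank ℂ W₁ : ℝ) <
        (ν.real (P₀ : Set G))⁻¹ * (Module.finrank ℂ W₀ : ℝ) + (ν.real (P₂ : Set G))⁻¹ * (Module.finrank ℂ W₂ : ℝ) := by
  rw [epFunction_apply_one_re ν τ₀ τ₂ τ₁ hfP₀ hfP₂ hfP₁, sub_pos]

/-- **The same inequality cleared of inverses** when the three volumes are positive (e.g. compact open subgroups under a Haar measure):
`0 < (f_EP 1).re ↔ ν(P₀)·ν(P₂)·dim₁ < ν(P₁)·(ν(P₂)·dim₀ + ν(P₀)·dim₂)`. [cite: Kottwitz1988, §2 Theorem 2] -/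
theorem epFunction_apply_one_re_pos_iff_of_pos
    (hfP₀ : ∀ (g : G) (hg : g ∈ P₀), f₀ g = τ₀.character ⟨g, hg⟩⁻¹)
    (hfP₂ : ∀ (g : G) (hg : g ∈ P₂), f₂ g = τ₂.character ⟨g, hg⟩⁻¹)
    (hfP₁ : ∀ (g : G) (hg : g ∈ P₁), f₁ g = τ₁.character ⟨g, hg⟩⁻¹)
    (h₀ : 0 < ν.real (P₀ : Set G)) (h₂ : 0 < ν.real (P₂ : Set G)) (h₁ : 0 < ν.real (P₁ : Set G)) :
    0 < (((((ν.real (P₀ : Set G))⁻¹ : ℂ)) • f₀ + (((ν.real (P₂ : Set G))⁻¹ : ℂ)) • f₂ - (((ν.real (P₁ : Set G))⁻¹ : ℂ)) • f₁) 1).re ↔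
      ν.real (P₀ : Set G) * ν.real (P₂ : Set G) * (Module.finrank ℂ W₁ : ℝ) <
        ν.real (P₁ : Set G) * (ν.real (P₂ : Set G) * (Module.finrank ℂ W₀ : ℝ) + ν.real (P₀ : Set G) * (Module.finrank ℂ W₂ : ℝ)) := by
  rw [epFunction_apply_one_re ν τ₀ τ₂ τ₁ hfP₀ hfP₂ hfP₁]
  have key : ν.real (P₁ : Set G) * (ν.real (P₂ : Set G) * (Module.finrank ℂ W₀ : ℝ) + ν.real (P₀ : Set G) * (Module.finrank ℂ W₂ : ℝ)) -
      ν.real (P₀ : Set G) * ν.real (P₂ : Set G) * (Module.finrank ℂ W₁ : ℝ) =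
      (ν.real (P₀ : Set G) * ν.real (P₂ : Set G) * ν.real (P₁ : Set G)) *
        ((ν.real (P₀ : Set G))⁻¹ * (Module.finrank ℂ W₀ : ℝ) + (ν.real (P₂ : Set G))⁻¹ * (Module.finrank ℂ W₂ : ℝ) -
          (ν.real (P₁ : Set G))⁻¹ * (Module.finrank ℂ W₁ : ℝ)) := by
    field_simp
  have hABC : 0 < ν.real (P₀ : Set G) * ν.real (P₂ : Set G) * ν.real (P₁ : Set G) := mul_pos (mul_pos h₀ h₂) h₁
  constructor
  · intro h
    exact sub_pos.1 (key ▸ mul_pos hABC h)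
  · intro h
    have h' := sub_pos.2 h
    rw [key] at h'
    exact (mul_pos_iff_of_pos_left hABC).1 h'

end Measure

/-! ## §3  Glue to the organ's POS-ONE ∃-form at a §12.5 datum -/

/-- **POS-ONE FROM THE EULER–POINCARÉ PSEUDO-COEFFICIENT.**  At a §12.5 datum `𝔇` on `(G, H)` (★ `Ch12Sec5.EllipticData`): if the K1 Euler–Poincaré function
`ν(P₀)⁻¹ • f₀ + ν(P₂)⁻¹ • f₂ − ν(P₁)⁻¹ • f₁` is a pseudo-coefficient of the class `σ` (★ K1's conclusion, BY SHAPE — `isPseudoCoeff_epFunction_of_unramified_explicit` ∕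
`…_of_neg_explicit` ∕ `…_of_ramificationIdx_ne_one_explicit`) and the K-type dimension inequality `ν(P₁)⁻¹·dim V^{U₁} < ν(P₀)⁻¹·dim V^{U₀} + ν(P₂)⁻¹·dim V^{U₂}` holds,
then `σ` satisfies the organ's POS-ONE form `∃ f, 𝔇.IsPseudoCoeff σ f ∧ 0 < (f 1).re ∧ (f 1).im = 0` (tier-0 `stub_pseudoCoeffPosOne`, ★ `Rung0TwentyTwo` :377) — print:
«`f_π(1) = d(π)` … Formal degrees are positive» [Rogawski1990 §12.7 p. 194], here without the Plancherel formula.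
[cite: Rogawski1990, §12.7 p. 194] [cite: Kottwitz1988, §2 Theorem 2] [cite: SchneiderStuhler1997, Thm. III.4.16] -/
theorem posOne_of_isPseudoCoeff_epFunction {G H : Type} [Group G] [TopologicalSpace G] [IsTopologicalGroup G] [MeasurableSpace G]
    [∀ γ : G, MeasurableSpace (G ⧸ Subgroup.centralizer ({γ} : Set G))] [MeasurableSpace (G ⧸ Subgroup.center G)]
    [Group H] [TopologicalSpace H] [IsTopologicalGroup H] [MeasurableSpace H]
    (𝔇 : EllipticData G H) (ν : Measure G) {P₀ P₂ P₁ : Subgroup G}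
    {W₀ W₂ W₁ : Type*} [AddCommGroup W₀] [Module ℂ W₀] [FiniteDimensional ℂ W₀] [AddCommGroup W₂] [Module ℂ W₂] [FiniteDimensional ℂ W₂]
    [AddCommGroup W₁] [Module ℂ W₁] [FiniteDimensional ℂ W₁]
    (τ₀ : Representation ℂ ↥P₀ W₀) (τ₂ : Representation ℂ ↥P₂ W₂) (τ₁ : Representation ℂ ↥P₁ W₁)
    {f₀ f₂ f₁ : G → ℂ}
    (hfP₀ : ∀ (g : G) (hg : g ∈ P₀), f₀ g = τ₀.character ⟨g, hg⟩⁻¹)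
    (hfP₂ : ∀ (g : G) (hg : g ∈ P₂), f₂ g = τ₂.character ⟨g, hg⟩⁻¹)
    (hfP₁ : ∀ (g : G) (hg : g ∈ P₁), f₁ g = τ₁.character ⟨g, hg⟩⁻¹)
    (σ : IrrClass G)
    (hpc : 𝔇.IsPseudoCoeff σ ((((ν.real (P₀ : Set G))⁻¹ : ℂ)) • f₀ + (((ν.real (P₂ : Set G))⁻¹ : ℂ)) • f₂ - (((ν.real (P₁ : Set G))⁻¹ : ℂ)) • f₁))
    (hlt : (ν.real (P₁ : Set G))⁻¹ * (Module.finrank ℂ W₁ : ℝ) <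
      (ν.real (P₀ : Set G))⁻¹ * (Module.finrank ℂ W₀ : ℝ) + (ν.real (P₂ : Set G))⁻¹ * (Module.finrank ℂ W₂ : ℝ)) :
    ∃ f : G → ℂ, 𝔇.IsPseudoCoeff σ f ∧ 0 < (f 1).re ∧ (f 1).im = 0 :=
  ⟨_, hpc, (epFunction_apply_one_re_pos_iff ν τ₀ τ₂ τ₁ hfP₀ hfP₂ hfP₁).2 hlt, epFunction_apply_one_im ν τ₀ τ₂ τ₁ hfP₀ hfP₂ hfP₁⟩

end Summit.HodgeConjecture.HodgeConjecture.Cruxes.H413.K2E3EPFunctionValueAtOne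

end
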